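import Mathlib
import Literature.Geometry.DiscreteGeometry.TwoShellPatterns

/-!
# Tight descent lemma for the line `Sketch` of crux `PhononSlackCertificates.NearFarGlueR`

Stub `stub_descentTight` of the skeleton for item stmt-AtomisticToContinuum-14970 (route
`PhononSlackCertificates`, crux `NearFarGlueR`).

**Statement.**  Granted the two sharp covering facts (for every unit vector `w` some first-shell
direction `v` of the fcc resp. hcp two-shell pattern has `⟪v, w⟫ ≥ 2/3`), if particle `i` is
`1/20`-good on the window `[47/50, 1]` then from ANY other particle `j ≠ i` some particle `k ≠ i`
within `21/20` of `x i` (an occupied first-shell site of `i`, possibly `k = j` itself) is STRICTLY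
closer to `x j` than `x i` is.  No distance hypothesis on `j` is needed: goodness of `i` forces
`dist (x j) (x i) ≥ 19a/20` for every `j ≠ i`.

**Proof.**  Let `a ∈ [47/50, 1]`, `A`, `P`, `f` witness the goodness of `i` and put
`d = dist (x j) (x i)`.  First `d ≥ 19a/20`: either `d > 3a/2`, or `j` lies in the
`3a/2`-neighbourhood of `x i`, hence `j = f v₀` for a pattern point `v₀` (`‖v₀‖ ∈ {1, √2}`), so
`x j` is within `a/20` of `x i + a • A v₀`, a point at distance `a‖v₀‖ ≥ a` from `x i`.
Next let `u = (x j - x i)/d`; the linear isometry `A` of `ℝ³` is onto (finite dimension), so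
`u = A w` with `‖w‖ = 1`, and the covering fact gives `v ∈ P`, `‖v‖ = 1`,
`⟪A v, u⟫ = ⟪v, w⟫ ≥ 2/3`.  Put `k = f v`, `y = x k - x i`, `z = a • A v`: `‖y - z‖ ≤ a/20`,
`‖z‖ = a`, so `‖y‖ ≤ 21a/20 ≤ 21/20` and `⟪x j - x i, y⟫ ≥ 2da/3 - da/20 = 37da/60`; hence
`dist (x j) (x k)² = d² - 2⟪x j - x i, y⟫ + ‖y‖² ≤ d² - 37da/30 + 441a²/400 < d²`
because `37da/30 ≥ (37/30)(19/20)a² = 703a²/600 > 441a²/400` for `a > 0`.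
-/

noncomputable section

namespace Summit.AtomisticToContinuum.Crystallization.Theorems.PhononSlackCertificatesNearFarGlueR

open Literature.Geometry.DiscreteGeometry
open scoped BigOperators RealInnerProductSpace

/-- **Core estimate of the tight descent lemma.**  In `ℝ³` let `‖p‖ = d ≥ 19a/20`,
`‖z‖ = a` with `0 < a ≤ 1`, `‖y - z‖ ≤ a/20` and `⟪p, z⟫ ≥ 2da/3`.  Then `‖y‖ ≤ 21/20` and
`‖p - y‖ < d`. [folklore] -/
theorem descentTight_core {p y z : EuclideanSpace ℝ (Fin 3)} {d a : ℝ} (hd : 19 / 20 * a ≤ d)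
    (ha0 : 0 < a) (ha1 : a ≤ 1) (hp : ‖p‖ = d) (hz : ‖z‖ = a) (hyz : ‖y - z‖ ≤ a / 20)
    (hinner : d * a * (2 / 3) ≤ ⟪p, z⟫) : ‖y‖ ≤ 21 / 20 ∧ ‖p - y‖ < d := by
  have hy : ‖y‖ ≤ 21 / 20 * a := by
    have h := norm_sub_norm_le y z
    linarith
  refine ⟨by nlinarith, ?_⟩
  have hd0 : 0 < d := by linarith
  have h1 : |⟪p, y - z⟫| ≤ d * (a / 20) := by
    calc |⟪p, y - z⟫| ≤ ‖p‖ * ‖y - z‖ := abs_real_inner_le_norm p (y - z)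
      _ ≤ d * (a / 20) := by
          rw [hp]
          exact mul_le_mul_of_nonneg_left hyz hd0.le
  have h1' := (abs_le.1 h1).1
  have h2 : ⟪p, y⟫ = ⟪p, z⟫ + ⟪p, y - z⟫ := by
    rw [inner_sub_right]
    ring
  have h3 : 37 / 60 * (d * a) ≤ ⟪p, y⟫ := by
    rw [h2]
    linarith
  have hyy : ‖y‖ ^ 2 ≤ (21 / 20 * a) ^ 2 := pow_le_pow_left₀ (norm_nonneg y) hy 2
  have hda : 19 / 20 * a * a ≤ d * a := mul_le_mul_of_nonneg_right hd ha0.le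
  have haa : 0 < a * a := mul_pos ha0 ha0
  have h4 : ‖p - y‖ ^ 2 < d ^ 2 := by
    rw [norm_sub_sq_real, hp]
    nlinarith
  exact lt_of_pow_lt_pow_left₀ 2 hd0.le h4

/-- **Tight descent lemma** (stub `stub_descentTight` of line `Sketch`, crux `NearFarGlueR`).
Granted the `2/3`-covering of the unit sphere by the first-shell directions of both two-shell
patterns: if particle `i` is `1/20`-good on the window `[47/50, 1]`, then for every particle
`j ≠ i` some particle `k ≠ i` within `21/20` of `x i` is strictly closer to `x j` than `x i` is.
[folklore] -/
theorem stub_descentTight :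
    (∀ w : EuclideanSpace ℝ (Fin 3), ‖w‖ = 1 →
      ∃ v ∈ fccTwoShellPattern, ‖v‖ = 1 ∧ (2 / 3 : ℝ) ≤ ⟪v, w⟫) →
    (∀ w : EuclideanSpace ℝ (Fin 3), ‖w‖ = 1 →
      ∃ v ∈ hcpTwoShellPattern, ‖v‖ = 1 ∧ (2 / 3 : ℝ) ≤ ⟪v, w⟫) →
    ∀ (N : ℕ) (x : Fin N → EuclideanSpace ℝ (Fin 3)) (i j : Fin N),
      IsTwoShellGood (1 / 20) (47 / 50) 1 x i → j ≠ i →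
      ∃ k : Fin N, k ≠ i ∧ dist (x k) (x i) ≤ 21 / 20 ∧ dist (x j) (x k) < dist (x j) (x i) := by
  intro hF hH N x i j hi hji
  obtain ⟨a, ha1, ha2, A, P, f, hP, hf, -, hsurj⟩ := hi
  -- the covering fact for the pattern `P`
  have hcov : ∀ w : EuclideanSpace ℝ (Fin 3), ‖w‖ = 1 →
      ∃ v ∈ P, ‖v‖ = 1 ∧ (2 / 3 : ℝ) ≤ ⟪v, w⟫ := by
    rcases hP with rfl | rfl
    exacts [hF, hH]
  -- every pattern point has norm at least `1`
  have hnorm : ∀ v ∈ P, 1 ≤ ‖v‖ := by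
    have h1 : (1 : ℝ) ≤ Real.sqrt 2 := Real.one_le_sqrt.mpr (by norm_num)
    intro v hv
    rcases hP with rfl | rfl
    · rcases norm_of_mem_fccTwoShellPattern hv with h | h
      · exact h.symm.le
      · rw [h]; exact h1
    · rcases norm_of_mem_hcpTwoShellPattern hv with h | h
      · exact h.symm.le
      · rw [h]; exact h1
  have ha0 : 0 < a := by linarith
  -- goodness of `i` keeps every other particle at distance `≥ 19a/20`
  have hdlow : 19 / 20 * a ≤ dist (x j) (x i) := by
    by_cases hle : dist (x j) (x i) ≤ 3 / 2 * a
    · obtain ⟨v₀, hv₀, hfv₀⟩ := hsurj j hji hle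
      obtain ⟨-, hk₀⟩ := hf v₀ hv₀
      rw [hfv₀] at hk₀
      have hz₀ : a ≤ ‖a • A v₀‖ := by
        rw [norm_smul, Real.norm_of_nonneg ha0.le, A.norm_map]
        have h := hnorm v₀ hv₀
        nlinarith
      have heq : dist (x i + a • A v₀) (x i) = ‖a • A v₀‖ := by
        rw [dist_eq_norm, add_sub_cancel_left]
      have htri := dist_triangle (x i + a • A v₀) (x j) (x i)
      rw [heq, dist_comm (x i + a • A v₀) (x j)] at htri
      linarith
    · have hlt := not_le.mp hle
      linarith
  set d := dist (x j) (x i) with hd_def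
  have hd0 : 0 < d := by linarith
  -- the unit direction from `x i` towards `x j`
  set p : EuclideanSpace ℝ (Fin 3) := x j - x i with hp_def
  have hp : ‖p‖ = d := by rw [hd_def, dist_eq_norm]
  set u : EuclideanSpace ℝ (Fin 3) := d⁻¹ • p with hu_def
  have hu : ‖u‖ = 1 := by
    rw [hu_def, norm_smul, norm_inv, Real.norm_of_nonneg hd0.le, hp, inv_mul_cancel₀ hd0.ne']
  have hpu : p = d • u := by rw [hu_def, smul_smul, mul_inv_cancel₀ hd0.ne', one_smul]
  -- pull `u` back through `A`, an isometric automorphism of the finite-dimensional space `ℝ³`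
  set w : EuclideanSpace ℝ (Fin 3) := (A.toLinearIsometryEquiv rfl).symm u with hw_def
  have hw : ‖w‖ = 1 := by rw [hw_def, LinearIsometryEquiv.norm_map, hu]
  have hAw : A w = u := by
    rw [hw_def, ← LinearIsometry.coe_toLinearIsometryEquiv A rfl]
    exact (A.toLinearIsometryEquiv rfl).apply_symm_apply u
  obtain ⟨v, hv, hv1, hvw⟩ := hcov w hw
  have hAvu : (2 / 3 : ℝ) ≤ ⟪u, A v⟫ := by
    rw [← hAw, LinearIsometry.inner_map_map, real_inner_comm]
    exact hvw
  obtain ⟨hki, hk⟩ := hf v hv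
  -- the core estimate with `y := x (f v) - x i`, `z := a • A v`
  have hz : ‖a • A v‖ = a := by
    rw [norm_smul, Real.norm_of_nonneg ha0.le, A.norm_map, hv1, mul_one]
  have hyz : ‖x (f v) - x i - a • A v‖ ≤ a / 20 := by
    rw [dist_eq_norm, sub_add_eq_sub_sub] at hk
    linarith
  have hinner : d * a * (2 / 3) ≤ ⟪p, a • A v⟫ := by
    rw [hpu, real_inner_smul_left, real_inner_smul_right]
    have h := mul_le_mul_of_nonneg_left hAvu (mul_pos hd0 ha0).le
    calc d * a * (2 / 3) ≤ d * a * ⟪u, A v⟫ := h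
      _ = d * (a * ⟪u, A v⟫) := by ring
  obtain ⟨h1, h2⟩ := descentTight_core hdlow ha0 ha2 hp hz hyz hinner
  refine ⟨f v, hki, ?_, ?_⟩
  · rwa [dist_eq_norm]
  · rw [dist_eq_norm, ← sub_sub_sub_cancel_right (x j) (x (f v)) (x i)]
    exact h2

end Summit.AtomisticToContinuum.Crystallization.Theorems.PhononSlackCertificatesNearFarGlueR

end
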